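import Literature.Probability.Percolation.ZdFiveArmSeparated
import Literature.Probability.Percolation.SqAnnulusDualBarrier
import Literature.Probability.Percolation.FourArmGarbanFencedArms
import HarnessLib

/-!
# Kesten's well-separated five-arm event on `ℤ²`: locality and the gluing of corridors to fences

Topic `Literature/Probability/Percolation`; bond percolation on `ℤ²`. Support file for the two
conditional theorems deducing, from Kesten's arm-separation theorem for the event `zdFiveArmSep`
(`ZdFiveArmSeparated.lean`), the point upper bound and the quasi-multiplicativity of the five-arm
probability of critical bond percolation on `ℤ²` (`DuminilCopinManolescuTassion2021_zdFiveArm_upperBound`,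
`ZdFiveArmUpperBound.lean`).  Everything here is deterministic (no measure): proved structural
lemmas about the four factors of `zdFiveArmSep n N`, plus four small definitions (carriers, fence
sites, zones).  No named fact.

* **Transport and locality.** `ZdSepOpenArmR.transport`, `ZdSepOpenArmL.transport`,
  `ZdSepDualArmT.transport`, `ZdSepDualArmB.transport` move a fenced arm of `ω` to a
  configuration `ω'` agreeing with `ω` on the pairs near the arm; `carrier_subset`,
  `fenceSites_subset` locate the arms in explicit ZONES `zdSepZoneR/L/T/B n N` (annulus plus boxes
  around the landing zones at both scales), whence `determinedBy_zdSepOpenPairR`,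
  `determinedBy_zdSepOpenArmL`, `determinedBy_zdSepDualArmT`, `determinedBy_zdSepDualArmB`:
  each factor is determined by the pairs of its zone (the form required by the generalised FKG
  inequality `bondPercolation_locallyMonotone_fkg`, Nolin 2008, Lemma 13, and by independence of
  disjoint regions).
* **Walk surgery.** `exists_prefix_reach_ge/le` (initial segment up/down to a level),
  `exists_segment_between` (a segment between two levels inside the slab),
  `exists_mem_support_of_vFence`, `exists_mem_support_of_hFence` (a crossing of a band meets a
  crossing of the fence box attached to it: the discrete Jordan lemma
  `exists_mem_support_of_crossing` of `PlanarDuality.lean`), `exists_walk_within_support`,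
  `exists_faceWalk_within_support`.
* **Gluing** (Kesten 1987, (2.43); Nolin 2008, proof of Prop. 12: "the free spaces `r_i` will
  allow us to use locally an FKG-type inequality to further extend the `c_i`'s"):
  `ZdSepOpenArmR.exists_walk_of_outerCorridor` / `…innerCorridor` and the `L`, `T`, `B` versions —
  an open (resp. closed-dual) crossing of the corridor attached outside an outer fence box (resp.
  inside an inner fence box) is joined to the arm through the fence crossing and the attaching
  walk, by an open walk inside the carrier (resp. a face walk across closed edges of the annulus
  and of the fence sites).  Because the landing intervals have length exactly `η N = N/64`, the
  fence box attached at the (random) endpoint always contains the FIXED band of the landing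
  interval, so fixed corridors can be used.

## References

* H. Kesten, *Scaling relations for 2D-percolation*, Comm. Math. Phys. 109 (1987), §2, (2.43)
  [KestenScalingCMP1987].
* P. Nolin, *Near-critical percolation in two dimensions*, EJP 13 (2008), §4.3, Prop. 12 and
  Lemma 13 (arXiv 0711.4948: Prop. 11, Lemma 12) [Nolin2008].

Tree: `ZdFiveArmSeparated.lean` (the structures and events), `SqAnnulusDualBarrier.lean`
(`mem_support_of_mem_edges_of_mem`), `PlanarDuality.lean` (`exists_mem_support_of_crossing`,
`sepEdge_apply_zero_le`), `FourArmGarbanFencedArms.lean` (`sepEdge_apply_one_le`),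
`FourArmGarbanTwoArms.lean` (`exists_prefix_exit`), `PercolationEvents.lean` (`DeterminedBy`).
Mathlib: `SimpleGraph.Walk.takeUntil`, `Set.sym2`.
-/

noncomputable section

open Set

namespace Literature.Probability.Percolation

open LatticeModels SimpleGraph


/-! ### Locality: transporting the fenced arms along configurations that agree near them -/

section Transport

variable {ω ω' : BondConfig (Site 2)} {n N : ℕ} {lo hi lo' hi' : ℤ}

/-- Both endpoints of an edge of a walk lie on the walk (restated for `Sym2` membership). [folklore] -/
theorem forall_mem_support_of_mem_edges {V : Type*} {G : SimpleGraph V} {x y : V}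
    (p : G.Walk x y) {ε : Sym2 V} (hε : ε ∈ p.edges) : ∀ v ∈ ε, v ∈ p.support :=
  fun _ hv => mem_support_of_mem_edges_of_mem p hε hv

namespace ZdSepOpenArmR

/-- **Transport of a fenced right arm**: if every pair of sites of the carrier that is open in
`ω` is open in `ω'`, a fenced right arm of `ω` is one of `ω'`, with the same carrier. [folklore] -/
def transport (A : ZdSepOpenArmR ω n N lo hi lo' hi')
    (h : ∀ e : Sym2 (Site 2), (∀ x ∈ e, x ∈ A.carrier) → e ∈ ω → e ∈ ω') :
    ZdSepOpenArmR ω' n N lo hi lo' hi' where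
  x := A.x
  z := A.z
  W := A.W
  hx := A.hx
  hz := A.hz
  hW := A.hW
  hWo e he := h e (fun v hv => Or.inl (forall_mem_support_of_mem_edges A.W he v hv)) (A.hWo e he)
  a := A.a
  b := A.b
  u := A.u
  V := A.V
  P := A.P
  hab := A.hab
  hV := A.hV
  hVo e he := h e (fun v hv => Or.inr (Or.inl (forall_mem_support_of_mem_edges A.V he v hv)))
    (A.hVo e he)
  hu := A.hu
  hP := A.hP
  hPo e he := h e (fun v hv => Or.inr (Or.inr (Or.inl (forall_mem_support_of_mem_edges A.P he v hv))))
    (A.hPo e he)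
  a' := A.a'
  b' := A.b'
  u' := A.u'
  V' := A.V'
  P' := A.P'
  hab' := A.hab'
  hV' := A.hV'
  hV'o e he := h e (fun v hv => Or.inr (Or.inr (Or.inr (Or.inl
    (forall_mem_support_of_mem_edges A.V' he v hv))))) (A.hV'o e he)
  hu' := A.hu'
  hP' := A.hP'
  hP'o e he := h e (fun v hv => Or.inr (Or.inr (Or.inr (Or.inr
    (forall_mem_support_of_mem_edges A.P' he v hv))))) (A.hP'o e he)

/-- `transport` does not change the carrier. [folklore] -/
@[simp] theorem carrier_transport (A : ZdSepOpenArmR ω n N lo hi lo' hi')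
    (h : ∀ e : Sym2 (Site 2), (∀ x ∈ e, x ∈ A.carrier) → e ∈ ω → e ∈ ω') :
    (A.transport h).carrier = A.carrier := rfl

/-- **Where a fenced right arm lives**: if the landing heights are bounded by `B` inside and
`B'` outside, every site of the carrier lies in the annulus, or in the outer right zone
`{N - N/8 ≤ x₀ ≤ N + N/8, |x₁| ≤ B' + N/64 + N/8}`, or in the inner right zone
`{n - n/8 ≤ x₀ ≤ n + n/8, |x₁| ≤ B + n/64 + n/8}`. [folklore] -/
theorem carrier_subset (A : ZdSepOpenArmR ω n N lo hi lo' hi') {B B' : ℤ}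
    (hlo : |lo| ≤ B) (hhi : |hi| ≤ B) (hlo' : |lo'| ≤ B') (hhi' : |hi'| ≤ B') :
    A.carrier ⊆ sqAnnulus n N ∪
      ({v | (N : ℤ) - (N / 8 : ℕ) ≤ v 0 ∧ v 0 ≤ N + (N / 8 : ℕ) ∧
          |v 1| ≤ B' + (N / 64 : ℕ) + (N / 8 : ℕ)} ∪
        {v | (n : ℤ) - (n / 8 : ℕ) ≤ v 0 ∧ v 0 ≤ n + (n / 8 : ℕ) ∧
          |v 1| ≤ B + (n / 64 : ℕ) + (n / 8 : ℕ)}) := by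
  have hz1 : |A.z 1| ≤ B' := by
    have := A.hz.2
    have h1 := abs_le.1 hlo'
    have h2 := abs_le.1 hhi'
    exact abs_le.2 ⟨by omega, by omega⟩
  have hx1 : |A.x 1| ≤ B := by
    have := A.hx.2
    have h1 := abs_le.1 hlo
    have h2 := abs_le.1 hhi
    exact abs_le.2 ⟨by omega, by omega⟩
  have hz0 := A.hz.1
  have hx0 := A.hx.1
  rintro v (hv | hv | hv | hv | hv)
  · exact Or.inl (A.hW v hv)
  · right; left
    obtain ⟨h1, h2, h3⟩ := A.hV v hv
    have := abs_sub_abs_le_abs_sub (v 1) (A.z 1)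
    refine ⟨by omega, h2, ?_⟩
    omega
  · right; left
    obtain ⟨h1, h2⟩ := A.hP v hv
    have e1 := abs_sub_abs_le_abs_sub (v 1) (A.z 1)
    have e0 := abs_le.1 (show |v 0 - A.z 0| ≤ (N / 8 : ℕ) by omega)
    refine ⟨by omega, by omega, by omega⟩
  · right; right
    obtain ⟨h1, h2, h3⟩ := A.hV' v hv
    have := abs_sub_abs_le_abs_sub (v 1) (A.x 1)
    exact ⟨h1, by omega, by omega⟩
  · right; right
    obtain ⟨h1, h2⟩ := A.hP' v hv
    have e1 := abs_sub_abs_le_abs_sub (v 1) (A.x 1)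
    have e0 := abs_le.1 (show |v 0 - A.x 0| ≤ (n / 8 : ℕ) by omega)
    exact ⟨by omega, by omega, by omega⟩

end ZdSepOpenArmR

namespace ZdSepOpenArmL

/-- The sites used by a fenced left arm. [folklore] -/
def carrier (A : ZdSepOpenArmL ω n N lo hi lo' hi') : Set (Site 2) :=
  {v | v ∈ A.W.support ∨ v ∈ A.V.support ∨ v ∈ A.P.support ∨ v ∈ A.V'.support ∨ v ∈ A.P'.support}

/-- **Transport of a fenced left arm** along configurations agreeing on the pairs of its
carrier. [folklore] -/
def transport (A : ZdSepOpenArmL ω n N lo hi lo' hi')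
    (h : ∀ e : Sym2 (Site 2), (∀ x ∈ e, x ∈ A.carrier) → e ∈ ω → e ∈ ω') :
    ZdSepOpenArmL ω' n N lo hi lo' hi' where
  x := A.x
  z := A.z
  W := A.W
  hx := A.hx
  hz := A.hz
  hW := A.hW
  hWo e he := h e (fun v hv => Or.inl (forall_mem_support_of_mem_edges A.W he v hv)) (A.hWo e he)
  a := A.a
  b := A.b
  u := A.u
  V := A.V
  P := A.P
  hab := A.hab
  hV := A.hV
  hVo e he := h e (fun v hv => Or.inr (Or.inl (forall_mem_support_of_mem_edges A.V he v hv)))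
    (A.hVo e he)
  hu := A.hu
  hP := A.hP
  hPo e he := h e (fun v hv => Or.inr (Or.inr (Or.inl (forall_mem_support_of_mem_edges A.P he v hv))))
    (A.hPo e he)
  a' := A.a'
  b' := A.b'
  u' := A.u'
  V' := A.V'
  P' := A.P'
  hab' := A.hab'
  hV' := A.hV'
  hV'o e he := h e (fun v hv => Or.inr (Or.inr (Or.inr (Or.inl
    (forall_mem_support_of_mem_edges A.V' he v hv))))) (A.hV'o e he)
  hu' := A.hu'
  hP' := A.hP'
  hP'o e he := h e (fun v hv => Or.inr (Or.inr (Or.inr (Or.inr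
    (forall_mem_support_of_mem_edges A.P' he v hv))))) (A.hP'o e he)

/-- **Where a fenced left arm lives**: annulus, outer left zone, inner left zone (landing
heights bounded by `B` inside, `B'` outside). [folklore] -/
theorem carrier_subset (A : ZdSepOpenArmL ω n N lo hi lo' hi') {B B' : ℤ}
    (hlo : |lo| ≤ B) (hhi : |hi| ≤ B) (hlo' : |lo'| ≤ B') (hhi' : |hi'| ≤ B') :
    A.carrier ⊆ sqAnnulus n N ∪
      ({v | -((N : ℤ) + (N / 8 : ℕ)) ≤ v 0 ∧ v 0 ≤ -(N : ℤ) + (N / 8 : ℕ) ∧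
          |v 1| ≤ B' + (N / 64 : ℕ) + (N / 8 : ℕ)} ∪
        {v | -((n : ℤ) + (n / 8 : ℕ)) ≤ v 0 ∧ v 0 ≤ -(n : ℤ) + (n / 8 : ℕ) ∧
          |v 1| ≤ B + (n / 64 : ℕ) + (n / 8 : ℕ)}) := by
  have hz1 : |A.z 1| ≤ B' := by
    have := A.hz.2
    have h1 := abs_le.1 hlo'
    have h2 := abs_le.1 hhi'
    exact abs_le.2 ⟨by omega, by omega⟩
  have hx1 : |A.x 1| ≤ B := by
    have := A.hx.2
    have h1 := abs_le.1 hlo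
    have h2 := abs_le.1 hhi
    exact abs_le.2 ⟨by omega, by omega⟩
  have hz0 := A.hz.1
  have hx0 := A.hx.1
  rintro v (hv | hv | hv | hv | hv)
  · exact Or.inl (A.hW v hv)
  · right; left
    obtain ⟨h1, h2, h3⟩ := A.hV v hv
    have := abs_sub_abs_le_abs_sub (v 1) (A.z 1)
    exact ⟨h1, by omega, by omega⟩
  · right; left
    obtain ⟨h1, h2⟩ := A.hP v hv
    have e1 := abs_sub_abs_le_abs_sub (v 1) (A.z 1)
    have e0 := abs_le.1 (show |v 0 - A.z 0| ≤ (N / 8 : ℕ) by omega)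
    exact ⟨by omega, by omega, by omega⟩
  · right; right
    obtain ⟨h1, h2, h3⟩ := A.hV' v hv
    have := abs_sub_abs_le_abs_sub (v 1) (A.x 1)
    exact ⟨by omega, h2, by omega⟩
  · right; right
    obtain ⟨h1, h2⟩ := A.hP' v hv
    have e1 := abs_sub_abs_le_abs_sub (v 1) (A.x 1)
    have e0 := abs_le.1 (show |v 0 - A.x 0| ≤ (n / 8 : ℕ) by omega)
    exact ⟨by omega, by omega, by omega⟩

end ZdSepOpenArmL

/-- Endpoints of the edge crossed by a step of a face walk, in terms of the two faces: first
coordinate in `[max z₀ z'₀, max z₀ z'₀ + 1]`, second in `[max z₁ z'₁, max z₁ z'₁ + 1]`. [folklore] -/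
theorem sepEdge_apply_le {z z' w : Site 2} (hw : w ∈ sepEdge z z') :
    (max (z 0) (z' 0) ≤ w 0 ∧ w 0 ≤ max (z 0) (z' 0) + 1) ∧
      (max (z 1) (z' 1) ≤ w 1 ∧ w 1 ≤ max (z 1) (z' 1) + 1) :=
  ⟨⟨(sepEdge_apply_zero_le hw).2, (sepEdge_apply_zero_le hw).1⟩,
    ⟨(sepEdge_apply_one_le hw).2, (sepEdge_apply_one_le hw).1⟩⟩

namespace ZdSepDualArmT

/-- The sites touched by the fences of a top dual arm: the endpoints of the edges crossed by its
two fence crossings and two attaching walks. [folklore] -/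
def fenceSites (A : ZdSepDualArmT ω n N lo hi lo' hi') : Set (Site 2) :=
  {v | (∃ d ∈ A.C.darts, v ∈ sepEdge d.fst d.snd) ∨ (∃ d ∈ A.P.darts, v ∈ sepEdge d.fst d.snd) ∨
    (∃ d ∈ A.C'.darts, v ∈ sepEdge d.fst d.snd) ∨ (∃ d ∈ A.P'.darts, v ∈ sepEdge d.fst d.snd)}

/-- **Transport of a fenced top dual arm**: if every pair with both endpoints in the annulus or in
the fence sites that is closed in `ω` is closed in `ω'`, a fenced top dual arm of `ω` is one of
`ω'`. [folklore] -/
def transport (A : ZdSepDualArmT ω n N lo hi lo' hi')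
    (h : ∀ e : Sym2 (Site 2), (∀ x ∈ e, x ∈ sqAnnulus n N ∪ A.fenceSites) → e ∉ ω → e ∉ ω') :
    ZdSepDualArmT ω' n N lo hi lo' hi' where
  f := A.f
  g := A.g
  Q := A.Q
  hf := A.hf
  hg := A.hg
  hQc d hd := h _ (fun v hv => Or.inl (A.hQa d hd v hv)) (A.hQc d hd)
  hQa := A.hQa
  a := A.a
  b := A.b
  u := A.u
  C := A.C
  P := A.P
  hab := A.hab
  hC := A.hC
  hCc d hd := h _ (fun _ hv => Or.inr (Or.inl ⟨d, hd, hv⟩)) (A.hCc d hd)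
  hu := A.hu
  hP := A.hP
  hPc d hd := h _ (fun _ hv => Or.inr (Or.inr (Or.inl ⟨d, hd, hv⟩))) (A.hPc d hd)
  a' := A.a'
  b' := A.b'
  u' := A.u'
  C' := A.C'
  P' := A.P'
  hab' := A.hab'
  hC' := A.hC'
  hC'c d hd := h _ (fun _ hv => Or.inr (Or.inr (Or.inr (Or.inl ⟨d, hd, hv⟩)))) (A.hC'c d hd)
  hu' := A.hu'
  hP' := A.hP'
  hP'c d hd := h _ (fun _ hv => Or.inr (Or.inr (Or.inr (Or.inr ⟨d, hd, hv⟩)))) (A.hP'c d hd)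

/-- **Where the fences of a top dual arm live**: the outer top zone
`{lo' - N/8 ≤ x₀ ≤ hi' + N/8 + 1, N - N/8 ≤ x₁ ≤ N + N/8 + 1}` and the inner top zone
`{lo - n/8 ≤ x₀ ≤ hi + n/8 + 1, n - 1 - n/8 ≤ x₁ ≤ n + n/8}`. [folklore] -/
theorem fenceSites_subset (A : ZdSepDualArmT ω n N lo hi lo' hi') :
    A.fenceSites ⊆
      {v | lo' - (N / 8 : ℕ) ≤ v 0 ∧ v 0 ≤ hi' + (N / 8 : ℕ) + 1 ∧
          (N : ℤ) - (N / 8 : ℕ) ≤ v 1 ∧ v 1 ≤ N + (N / 8 : ℕ) + 1} ∪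
        {v | lo - (n / 8 : ℕ) ≤ v 0 ∧ v 0 ≤ hi + (n / 8 : ℕ) + 1 ∧
          (n : ℤ) - 1 - (n / 8 : ℕ) ≤ v 1 ∧ v 1 ≤ n + (n / 8 : ℕ)} := by
  have hg := A.hg
  have hf := A.hf
  have hHE : ((N / 64 : ℕ) : ℤ) ≤ (N / 8 : ℕ) := by exact_mod_cast Nat.div_le_div_left (by norm_num) (by norm_num)
  have hhe : ((n / 64 : ℕ) : ℤ) ≤ (n / 8 : ℕ) := by exact_mod_cast Nat.div_le_div_left (by norm_num) (by norm_num)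
  rintro v (⟨d, hd, hv⟩ | ⟨d, hd, hv⟩ | ⟨d, hd, hv⟩ | ⟨d, hd, hv⟩)
  · left
    obtain ⟨⟨h0, h0'⟩, ⟨h1, h1'⟩⟩ := sepEdge_apply_le hv
    obtain ⟨a0, a1, a1'⟩ := A.hC _ (A.C.dart_fst_mem_support_of_mem_darts hd)
    obtain ⟨b0, b1, b1'⟩ := A.hC _ (A.C.dart_snd_mem_support_of_mem_darts hd)
    have ea := abs_le.1 a0
    have eb := abs_le.1 b0
    refine ⟨?_, ?_, ?_, ?_⟩
    · have : A.g 0 - (N / 64 : ℕ) ≤ max (d.toProd.1 0) (d.toProd.2 0) := le_max_of_le_left (by omega)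
      omega
    · have : max (d.toProd.1 0) (d.toProd.2 0) ≤ A.g 0 + (N / 64 : ℕ) := max_le (by omega) (by omega)
      omega
    · have : (N : ℤ) + 1 ≤ max (d.toProd.1 1) (d.toProd.2 1) := le_max_of_le_left a1
      omega
    · have : max (d.toProd.1 1) (d.toProd.2 1) ≤ N + (N / 8 : ℕ) := max_le a1' b1'
      omega
  · left
    obtain ⟨⟨h0, h0'⟩, ⟨h1, h1'⟩⟩ := sepEdge_apply_le hv
    obtain ⟨a0, a1⟩ := A.hP _ (A.P.dart_fst_mem_support_of_mem_darts hd)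
    obtain ⟨b0, b1⟩ := A.hP _ (A.P.dart_snd_mem_support_of_mem_darts hd)
    have ea0 := abs_le.1 (show |d.toProd.1 0 - A.g 0| ≤ (N / 8 : ℕ) by omega)
    have eb0 := abs_le.1 (show |d.toProd.2 0 - A.g 0| ≤ (N / 8 : ℕ) by omega)
    have ea1 := abs_le.1 (show |d.toProd.1 1 - A.g 1| ≤ (N / 8 : ℕ) - 1 by omega)
    have eb1 := abs_le.1 (show |d.toProd.2 1 - A.g 1| ≤ (N / 8 : ℕ) - 1 by omega)
    refine ⟨?_, ?_, ?_, ?_⟩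
    · have : A.g 0 - (N / 8 : ℕ) ≤ max (d.toProd.1 0) (d.toProd.2 0) := le_max_of_le_left (by omega)
      omega
    · have : max (d.toProd.1 0) (d.toProd.2 0) ≤ A.g 0 + (N / 8 : ℕ) := max_le (by omega) (by omega)
      omega
    · have : A.g 1 - (N / 8 : ℕ) + 1 ≤ max (d.toProd.1 1) (d.toProd.2 1) := le_max_of_le_left (by omega)
      omega
    · have : max (d.toProd.1 1) (d.toProd.2 1) ≤ A.g 1 + (N / 8 : ℕ) - 1 := max_le (by omega) (by omega)
      omega
  · right
    obtain ⟨⟨h0, h0'⟩, ⟨h1, h1'⟩⟩ := sepEdge_apply_le hv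
    obtain ⟨a0, a1, a1'⟩ := A.hC' _ (A.C'.dart_fst_mem_support_of_mem_darts hd)
    obtain ⟨b0, b1, b1'⟩ := A.hC' _ (A.C'.dart_snd_mem_support_of_mem_darts hd)
    have ea := abs_le.1 a0
    have eb := abs_le.1 b0
    refine ⟨?_, ?_, ?_, ?_⟩
    · have : A.f 0 - (n / 64 : ℕ) ≤ max (d.toProd.1 0) (d.toProd.2 0) := le_max_of_le_left (by omega)
      omega
    · have : max (d.toProd.1 0) (d.toProd.2 0) ≤ A.f 0 + (n / 64 : ℕ) := max_le (by omega) (by omega)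
      omega
    · have : (n : ℤ) - 1 - (n / 8 : ℕ) ≤ max (d.toProd.1 1) (d.toProd.2 1) := le_max_of_le_left a1
      omega
    · have : max (d.toProd.1 1) (d.toProd.2 1) + 2 ≤ n :=
        by rcases le_total (d.toProd.1 1) (d.toProd.2 1) with hle | hle <;> simp [hle] <;> assumption
      omega
  · right
    obtain ⟨⟨h0, h0'⟩, ⟨h1, h1'⟩⟩ := sepEdge_apply_le hv
    obtain ⟨a0, a1⟩ := A.hP' _ (A.P'.dart_fst_mem_support_of_mem_darts hd)
    obtain ⟨b0, b1⟩ := A.hP' _ (A.P'.dart_snd_mem_support_of_mem_darts hd)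
    have ea0 := abs_le.1 (show |d.toProd.1 0 - A.f 0| ≤ (n / 8 : ℕ) by omega)
    have eb0 := abs_le.1 (show |d.toProd.2 0 - A.f 0| ≤ (n / 8 : ℕ) by omega)
    have ea1 := abs_le.1 (show |d.toProd.1 1 - A.f 1| ≤ (n / 8 : ℕ) - 1 by omega)
    have eb1 := abs_le.1 (show |d.toProd.2 1 - A.f 1| ≤ (n / 8 : ℕ) - 1 by omega)
    refine ⟨?_, ?_, ?_, ?_⟩
    · have : A.f 0 - (n / 8 : ℕ) ≤ max (d.toProd.1 0) (d.toProd.2 0) := le_max_of_le_left (by omega)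
      omega
    · have : max (d.toProd.1 0) (d.toProd.2 0) ≤ A.f 0 + (n / 8 : ℕ) := max_le (by omega) (by omega)
      omega
    · have : A.f 1 - (n / 8 : ℕ) + 1 ≤ max (d.toProd.1 1) (d.toProd.2 1) := le_max_of_le_left (by omega)
      omega
    · have : max (d.toProd.1 1) (d.toProd.2 1) ≤ A.f 1 + (n / 8 : ℕ) - 1 := max_le (by omega) (by omega)
      omega

end ZdSepDualArmT

end Transport

namespace ZdSepDualArmB

variable {ω ω' : BondConfig (Site 2)} {n N : ℕ} {lo hi lo' hi' : ℤ}

/-- The sites touched by the fences of a bottom dual arm. [folklore] -/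
def fenceSites (A : ZdSepDualArmB ω n N lo hi lo' hi') : Set (Site 2) :=
  {v | (∃ d ∈ A.C.darts, v ∈ sepEdge d.fst d.snd) ∨ (∃ d ∈ A.P.darts, v ∈ sepEdge d.fst d.snd) ∨
    (∃ d ∈ A.C'.darts, v ∈ sepEdge d.fst d.snd) ∨ (∃ d ∈ A.P'.darts, v ∈ sepEdge d.fst d.snd)}

/-- **Transport of a fenced bottom dual arm** along configurations whose closed pairs near it
stay closed. [folklore] -/
def transport (A : ZdSepDualArmB ω n N lo hi lo' hi')
    (h : ∀ e : Sym2 (Site 2), (∀ x ∈ e, x ∈ sqAnnulus n N ∪ A.fenceSites) → e ∉ ω → e ∉ ω') :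
    ZdSepDualArmB ω' n N lo hi lo' hi' where
  f := A.f
  g := A.g
  Q := A.Q
  hf := A.hf
  hg := A.hg
  hQc d hd := h _ (fun v hv => Or.inl (A.hQa d hd v hv)) (A.hQc d hd)
  hQa := A.hQa
  a := A.a
  b := A.b
  u := A.u
  C := A.C
  P := A.P
  hab := A.hab
  hC := A.hC
  hCc d hd := h _ (fun _ hv => Or.inr (Or.inl ⟨d, hd, hv⟩)) (A.hCc d hd)
  hu := A.hu
  hP := A.hP
  hPc d hd := h _ (fun _ hv => Or.inr (Or.inr (Or.inl ⟨d, hd, hv⟩))) (A.hPc d hd)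
  a' := A.a'
  b' := A.b'
  u' := A.u'
  C' := A.C'
  P' := A.P'
  hab' := A.hab'
  hC' := A.hC'
  hC'c d hd := h _ (fun _ hv => Or.inr (Or.inr (Or.inr (Or.inl ⟨d, hd, hv⟩)))) (A.hC'c d hd)
  hu' := A.hu'
  hP' := A.hP'
  hP'c d hd := h _ (fun _ hv => Or.inr (Or.inr (Or.inr (Or.inr ⟨d, hd, hv⟩)))) (A.hP'c d hd)

/-- **Where the fences of a bottom dual arm live**: the outer bottom zone
`{lo' - N/8 ≤ x₀ ≤ hi' + N/8 + 1, -N - N/8 - 1 ≤ x₁ ≤ -N + N/8}` and the inner bottom zone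
`{lo - n/8 ≤ x₀ ≤ hi + n/8 + 1, -n - n/8 + 1 ≤ x₁ ≤ -n + n/8 + 1}`. [folklore] -/
theorem fenceSites_subset (A : ZdSepDualArmB ω n N lo hi lo' hi') :
    A.fenceSites ⊆
      {v | lo' - (N / 8 : ℕ) ≤ v 0 ∧ v 0 ≤ hi' + (N / 8 : ℕ) + 1 ∧
          -(N : ℤ) - (N / 8 : ℕ) - 1 ≤ v 1 ∧ v 1 ≤ -(N : ℤ) + (N / 8 : ℕ)} ∪
        {v | lo - (n / 8 : ℕ) ≤ v 0 ∧ v 0 ≤ hi + (n / 8 : ℕ) + 1 ∧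
          -(n : ℤ) - (n / 8 : ℕ) + 1 ≤ v 1 ∧ v 1 ≤ -(n : ℤ) + (n / 8 : ℕ) + 1} := by
  have hg := A.hg
  have hf := A.hf
  rintro v (⟨d, hd, hv⟩ | ⟨d, hd, hv⟩ | ⟨d, hd, hv⟩ | ⟨d, hd, hv⟩)
  · left
    obtain ⟨⟨h0, h0'⟩, ⟨h1, h1'⟩⟩ := sepEdge_apply_le hv
    obtain ⟨a0, a1, a1'⟩ := A.hC _ (A.C.dart_fst_mem_support_of_mem_darts hd)
    obtain ⟨b0, b1, b1'⟩ := A.hC _ (A.C.dart_snd_mem_support_of_mem_darts hd)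
    have ea := abs_le.1 a0
    have eb := abs_le.1 b0
    refine ⟨?_, ?_, ?_, ?_⟩
    · have : A.g 0 - (N / 64 : ℕ) ≤ max (d.toProd.1 0) (d.toProd.2 0) := le_max_of_le_left (by omega)
      omega
    · have : max (d.toProd.1 0) (d.toProd.2 0) ≤ A.g 0 + (N / 64 : ℕ) := max_le (by omega) (by omega)
      omega
    · have : -((N : ℤ) + 1 + (N / 8 : ℕ)) ≤ max (d.toProd.1 1) (d.toProd.2 1) := le_max_of_le_left a1
      omega
    · have : max (d.toProd.1 1) (d.toProd.2 1) + 2 ≤ -(N : ℤ) :=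
        by rcases le_total (d.toProd.1 1) (d.toProd.2 1) with hle | hle <;> simp [hle] <;> assumption
      omega
  · left
    obtain ⟨⟨h0, h0'⟩, ⟨h1, h1'⟩⟩ := sepEdge_apply_le hv
    obtain ⟨a0, a1⟩ := A.hP _ (A.P.dart_fst_mem_support_of_mem_darts hd)
    obtain ⟨b0, b1⟩ := A.hP _ (A.P.dart_snd_mem_support_of_mem_darts hd)
    have ea0 := abs_le.1 (show |d.toProd.1 0 - A.g 0| ≤ (N / 8 : ℕ) by omega)
    have eb0 := abs_le.1 (show |d.toProd.2 0 - A.g 0| ≤ (N / 8 : ℕ) by omega)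
    have ea1 := abs_le.1 (show |d.toProd.1 1 - A.g 1| ≤ (N / 8 : ℕ) - 1 by omega)
    have eb1 := abs_le.1 (show |d.toProd.2 1 - A.g 1| ≤ (N / 8 : ℕ) - 1 by omega)
    refine ⟨?_, ?_, ?_, ?_⟩
    · have : A.g 0 - (N / 8 : ℕ) ≤ max (d.toProd.1 0) (d.toProd.2 0) := le_max_of_le_left (by omega)
      omega
    · have : max (d.toProd.1 0) (d.toProd.2 0) ≤ A.g 0 + (N / 8 : ℕ) := max_le (by omega) (by omega)
      omega
    · have : A.g 1 - (N / 8 : ℕ) + 1 ≤ max (d.toProd.1 1) (d.toProd.2 1) := le_max_of_le_left (by omega)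
      omega
    · have : max (d.toProd.1 1) (d.toProd.2 1) ≤ A.g 1 + (N / 8 : ℕ) - 1 := max_le (by omega) (by omega)
      omega
  · right
    obtain ⟨⟨h0, h0'⟩, ⟨h1, h1'⟩⟩ := sepEdge_apply_le hv
    obtain ⟨a0, a1, a1'⟩ := A.hC' _ (A.C'.dart_fst_mem_support_of_mem_darts hd)
    obtain ⟨b0, b1, b1'⟩ := A.hC' _ (A.C'.dart_snd_mem_support_of_mem_darts hd)
    have ea := abs_le.1 a0
    have eb := abs_le.1 b0
    refine ⟨?_, ?_, ?_, ?_⟩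
    · have : A.f 0 - (n / 64 : ℕ) ≤ max (d.toProd.1 0) (d.toProd.2 0) := le_max_of_le_left (by omega)
      omega
    · have : max (d.toProd.1 0) (d.toProd.2 0) ≤ A.f 0 + (n / 64 : ℕ) := max_le (by omega) (by omega)
      omega
    · have : -(n : ℤ) + 1 ≤ max (d.toProd.1 1) (d.toProd.2 1) := le_max_of_le_left a1
      omega
    · have : max (d.toProd.1 1) (d.toProd.2 1) ≤ -(n : ℤ) + (n / 8 : ℕ) := max_le a1' b1'
      omega
  · right
    obtain ⟨⟨h0, h0'⟩, ⟨h1, h1'⟩⟩ := sepEdge_apply_le hv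
    obtain ⟨a0, a1⟩ := A.hP' _ (A.P'.dart_fst_mem_support_of_mem_darts hd)
    obtain ⟨b0, b1⟩ := A.hP' _ (A.P'.dart_snd_mem_support_of_mem_darts hd)
    have ea0 := abs_le.1 (show |d.toProd.1 0 - A.f 0| ≤ (n / 8 : ℕ) by omega)
    have eb0 := abs_le.1 (show |d.toProd.2 0 - A.f 0| ≤ (n / 8 : ℕ) by omega)
    have ea1 := abs_le.1 (show |d.toProd.1 1 - A.f 1| ≤ (n / 8 : ℕ) - 1 by omega)
    have eb1 := abs_le.1 (show |d.toProd.2 1 - A.f 1| ≤ (n / 8 : ℕ) - 1 by omega)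
    refine ⟨?_, ?_, ?_, ?_⟩
    · have : A.f 0 - (n / 8 : ℕ) ≤ max (d.toProd.1 0) (d.toProd.2 0) := le_max_of_le_left (by omega)
      omega
    · have : max (d.toProd.1 0) (d.toProd.2 0) ≤ A.f 0 + (n / 8 : ℕ) := max_le (by omega) (by omega)
      omega
    · have : A.f 1 - (n / 8 : ℕ) + 1 ≤ max (d.toProd.1 1) (d.toProd.2 1) := le_max_of_le_left (by omega)
      omega
    · have : max (d.toProd.1 1) (d.toProd.2 1) ≤ A.f 1 + (n / 8 : ℕ) - 1 := max_le (by omega) (by omega)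
      omega

end ZdSepDualArmB

/-! ### Locality: the four factors are determined by the pairs of explicit finite zones -/

section Zones

/-- **The right zone**: annulus, outer right zone `{N - N/8 ≤ x₀ ≤ N + N/8, |x₁| ≤ N/4 + 2·N/64 + N/8}`
and inner right zone; it contains the carriers of both fenced right arms. [folklore] -/
def zdSepZoneR (n N : ℕ) : Set (Site 2) :=
  sqAnnulus n N ∪
    ({v | (N : ℤ) - (N / 8 : ℕ) ≤ v 0 ∧ v 0 ≤ N + (N / 8 : ℕ) ∧
        |v 1| ≤ ((N / 4 : ℕ) : ℤ) + (N / 64 : ℕ) + (N / 64 : ℕ) + (N / 8 : ℕ)} ∪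
      {v | (n : ℤ) - (n / 8 : ℕ) ≤ v 0 ∧ v 0 ≤ n + (n / 8 : ℕ) ∧
        |v 1| ≤ ((n / 4 : ℕ) : ℤ) + (n / 64 : ℕ) + (n / 64 : ℕ) + (n / 8 : ℕ)})

/-- **The left zone**: annulus, outer left zone `{-N - N/8 ≤ x₀ ≤ -N + N/8, |x₁| ≤ 2·N/64 + N/8}`
and inner left zone; it contains the carrier of the fenced left arm. [folklore] -/
def zdSepZoneL (n N : ℕ) : Set (Site 2) :=
  sqAnnulus n N ∪
    ({v | -((N : ℤ) + (N / 8 : ℕ)) ≤ v 0 ∧ v 0 ≤ -(N : ℤ) + (N / 8 : ℕ) ∧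
        |v 1| ≤ ((N / 64 : ℕ) : ℤ) + (N / 64 : ℕ) + (N / 8 : ℕ)} ∪
      {v | -((n : ℤ) + (n / 8 : ℕ)) ≤ v 0 ∧ v 0 ≤ -(n : ℤ) + (n / 8 : ℕ) ∧
        |v 1| ≤ ((n / 64 : ℕ) : ℤ) + (n / 64 : ℕ) + (n / 8 : ℕ)})

/-- **The top zone**: annulus, outer top zone `{-N/8 ≤ x₀ ≤ N/64 + N/8 + 1, N - N/8 ≤ x₁ ≤ N + N/8 + 1}`
and inner top zone; it contains the endpoints of all edges crossed by a fenced top dual arm. [folklore] -/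
def zdSepZoneT (n N : ℕ) : Set (Site 2) :=
  sqAnnulus n N ∪
    ({v | -((N / 8 : ℕ) : ℤ) ≤ v 0 ∧ v 0 ≤ ((N / 64 : ℕ) : ℤ) + (N / 8 : ℕ) + 1 ∧
        (N : ℤ) - (N / 8 : ℕ) ≤ v 1 ∧ v 1 ≤ N + (N / 8 : ℕ) + 1} ∪
      {v | -((n / 8 : ℕ) : ℤ) ≤ v 0 ∧ v 0 ≤ ((n / 64 : ℕ) : ℤ) + (n / 8 : ℕ) + 1 ∧
        (n : ℤ) - 1 - (n / 8 : ℕ) ≤ v 1 ∧ v 1 ≤ n + (n / 8 : ℕ)})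

/-- **The bottom zone** (mirror image of the top zone). [folklore] -/
def zdSepZoneB (n N : ℕ) : Set (Site 2) :=
  sqAnnulus n N ∪
    ({v | -((N / 8 : ℕ) : ℤ) ≤ v 0 ∧ v 0 ≤ ((N / 64 : ℕ) : ℤ) + (N / 8 : ℕ) + 1 ∧
        -(N : ℤ) - (N / 8 : ℕ) - 1 ≤ v 1 ∧ v 1 ≤ -(N : ℤ) + (N / 8 : ℕ)} ∪
      {v | -((n / 8 : ℕ) : ℤ) ≤ v 0 ∧ v 0 ≤ ((n / 64 : ℕ) : ℤ) + (n / 8 : ℕ) + 1 ∧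
        -(n : ℤ) - (n / 8 : ℕ) + 1 ≤ v 1 ∧ v 1 ≤ -(n : ℤ) + (n / 8 : ℕ) + 1})

variable {n N : ℕ}

/-- A pair all of whose members lie in `Z` is a pair of `Z`. [folklore] -/
theorem mem_sym2_of_forall {Z : Set (Site 2)} {e : Sym2 (Site 2)} (h : ∀ x ∈ e, x ∈ Z) :
    e ∈ Z.sym2 :=
  Set.mem_sym2_iff_subset.2 fun x hx => h x hx

/-- Two configurations agreeing on `F` agree on every pair of `F` (forward direction). [folklore] -/
theorem mem_of_inter_eq {F : Set (Sym2 (Site 2))} {ω ω' : BondConfig (Site 2)} (h : ω ∩ F = ω' ∩ F)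
    {e : Sym2 (Site 2)} (he : e ∈ F) (heω : e ∈ ω) : e ∈ ω' :=
  ((Set.ext_iff.1 h e).1 ⟨heω, he⟩).1

/-- **The right pair event is determined by the pairs of the right zone.** [folklore] -/
theorem determinedBy_zdSepOpenPairR {F : Set (Sym2 (Site 2))} (hF : (zdSepZoneR n N).sym2 ⊆ F) :
    DeterminedBy (zdSepOpenPairR n N) F := by
  have hB : ∀ {ω : BondConfig (Site 2)} {lo hi lo' hi' : ℤ} (A : ZdSepOpenArmR ω n N lo hi lo' hi'),
      |lo| ≤ ((n / 4 : ℕ) : ℤ) + (n / 64 : ℕ) → |hi| ≤ ((n / 4 : ℕ) : ℤ) + (n / 64 : ℕ) →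
      |lo'| ≤ ((N / 4 : ℕ) : ℤ) + (N / 64 : ℕ) → |hi'| ≤ ((N / 4 : ℕ) : ℤ) + (N / 64 : ℕ) →
      A.carrier ⊆ zdSepZoneR n N := by
    intro ω lo hi lo' hi' A h1 h2 h3 h4 v hv
    rcases A.carrier_subset h1 h2 h3 h4 hv with h | h | h
    · exact Or.inl h
    · exact Or.inr (Or.inl ⟨h.1, h.2.1, by have := h.2.2; push_cast at this ⊢; omega⟩)
    · exact Or.inr (Or.inr ⟨h.1, h.2.1, by have := h.2.2; push_cast at this ⊢; omega⟩)
  suffices key : ∀ ω ω' : BondConfig (Site 2), ω ∩ F = ω' ∩ F →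
      ω ∈ zdSepOpenPairR n N → ω' ∈ zdSepOpenPairR n N by
    rw [determinedBy_iff]
    exact fun ω ω' h => ⟨key ω ω' h, key ω' ω h.symm⟩
  rintro ω ω' h ⟨A, B, hAB⟩
  have hA := hB A (abs_le.2 ⟨by omega, by omega⟩) (abs_le.2 ⟨by omega, by omega⟩)
    (abs_le.2 ⟨by omega, by omega⟩) (abs_le.2 ⟨by omega, by omega⟩)
  have hB' := hB B (abs_le.2 ⟨by omega, by omega⟩) (abs_le.2 ⟨by omega, by omega⟩)
    (abs_le.2 ⟨by omega, by omega⟩) (abs_le.2 ⟨by omega, by omega⟩)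
  refine ⟨A.transport fun e he heω => mem_of_inter_eq h (hF (mem_sym2_of_forall fun x hx => hA (he x hx))) heω,
    B.transport fun e he heω => mem_of_inter_eq h (hF (mem_sym2_of_forall fun x hx => hB' (he x hx))) heω,
    ?_⟩
  simpa using hAB

/-- **The left arm event is determined by the pairs of the left zone.** [folklore] -/
theorem determinedBy_zdSepOpenArmL {F : Set (Sym2 (Site 2))} (hF : (zdSepZoneL n N).sym2 ⊆ F) :
    DeterminedBy (zdSepOpenArmL n N) F := by
  suffices key : ∀ ω ω' : BondConfig (Site 2), ω ∩ F = ω' ∩ F →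
      ω ∈ zdSepOpenArmL n N → ω' ∈ zdSepOpenArmL n N by
    rw [determinedBy_iff]
    exact fun ω ω' h => ⟨key ω ω' h, key ω' ω h.symm⟩
  rintro ω ω' h ⟨A⟩
  have hA : A.carrier ⊆ zdSepZoneL n N := by
    intro v hv
    rcases A.carrier_subset (B := (n / 64 : ℕ)) (B' := (N / 64 : ℕ)) (abs_le.2 ⟨by omega, by omega⟩)
      (abs_le.2 ⟨by omega, by omega⟩) (abs_le.2 ⟨by omega, by omega⟩) (abs_le.2 ⟨by omega, by omega⟩)
      hv with h | h | h
    · exact Or.inl h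
    · exact Or.inr (Or.inl h)
    · exact Or.inr (Or.inr h)
  exact ⟨A.transport fun e he heω => mem_of_inter_eq h (hF (mem_sym2_of_forall fun x hx => hA (he x hx))) heω⟩

/-- **The top dual arm event is determined by the pairs of the top zone.** [folklore] -/
theorem determinedBy_zdSepDualArmT {F : Set (Sym2 (Site 2))} (hF : (zdSepZoneT n N).sym2 ⊆ F) :
    DeterminedBy (zdSepDualArmT n N) F := by
  suffices key : ∀ ω ω' : BondConfig (Site 2), ω ∩ F = ω' ∩ F →
      ω' ∈ zdSepDualArmT n N → ω ∈ zdSepDualArmT n N by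
    rw [determinedBy_iff]
    exact fun ω ω' h => ⟨key ω' ω h.symm, key ω ω' h⟩
  rintro ω ω' h ⟨A⟩
  have hA : sqAnnulus n N ∪ A.fenceSites ⊆ zdSepZoneT n N := by
    rintro v (hv | hv)
    · exact Or.inl hv
    · rcases A.fenceSites_subset hv with h | h
      · exact Or.inr (Or.inl ⟨by have := h.1; omega, h.2.1, h.2.2⟩)
      · exact Or.inr (Or.inr ⟨by have := h.1; omega, h.2.1, h.2.2⟩)
  exact ⟨A.transport fun e he heω' heω => heω' (mem_of_inter_eq h (hF (mem_sym2_of_forall fun x hx => hA (he x hx))) heω)⟩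

/-- **The bottom dual arm event is determined by the pairs of the bottom zone.** [folklore] -/
theorem determinedBy_zdSepDualArmB {F : Set (Sym2 (Site 2))} (hF : (zdSepZoneB n N).sym2 ⊆ F) :
    DeterminedBy (zdSepDualArmB n N) F := by
  suffices key : ∀ ω ω' : BondConfig (Site 2), ω ∩ F = ω' ∩ F →
      ω' ∈ zdSepDualArmB n N → ω ∈ zdSepDualArmB n N by
    rw [determinedBy_iff]
    exact fun ω ω' h => ⟨key ω' ω h.symm, key ω ω' h⟩
  rintro ω ω' h ⟨A⟩
  have hA : sqAnnulus n N ∪ A.fenceSites ⊆ zdSepZoneB n N := by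
    rintro v (hv | hv)
    · exact Or.inl hv
    · rcases A.fenceSites_subset hv with h | h
      · exact Or.inr (Or.inl ⟨by have := h.1; omega, h.2.1, h.2.2⟩)
      · exact Or.inr (Or.inr ⟨by have := h.1; omega, h.2.1, h.2.2⟩)
  exact ⟨A.transport fun e he heω' heω => heω' (mem_of_inter_eq h (hF (mem_sym2_of_forall fun x hx => hA (he x hx))) heω)⟩

end Zones

/-! ### Walk surgery: prefixes reaching a level, segments between two levels, meeting a fence -/

section Surgery

variable {a b : Site 2}

/-- **Prefix up to a level.** If a lattice walk starts with `i`-th coordinate `≤ c` and ends with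
`i`-th coordinate `≥ c`, an initial segment of it (vertices and edges of the walk) ends on the
level `{x_i = c}` and stays in `{x_i ≤ c}`. [folklore] -/
theorem exists_prefix_reach_ge (i : Fin 2) (W : (zdGraph 2).Walk a b) (c : ℤ) (ha : a i ≤ c)
    (hb : c ≤ b i) :
    ∃ (q : Site 2) (U : (zdGraph 2).Walk a q), q i = c ∧
      (∀ z ∈ U.support, z i ≤ c ∧ z ∈ W.support) ∧ ∀ e ∈ U.edges, e ∈ W.edges := by
  rcases eq_or_lt_of_le ha with hac | hac
  · exact ⟨a, Walk.nil, hac, fun z hz => by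
      rw [Walk.support_nil, List.mem_singleton] at hz; subst hz; exact ⟨ha, W.start_mem_support⟩,
      fun e he => by simp at he⟩
  · obtain ⟨x, z, q₁, hxz, hz, hA, hS, hE, hlast⟩ :=
      exists_prefix_exit (A := {x : Site 2 | x i < c}) W hac (not_lt.2 hb)
    have hzc : z i = c := by
      have h1 : x i < c := hA x q₁.end_mem_support
      have h2 : ¬ z i < c := hz
      have := zdGraph_adj_apply_le hxz i
      omega
    refine ⟨z, q₁.concat hxz, hzc, fun w hw => ?_, fun e he => ?_⟩
    · rw [Walk.support_concat, List.mem_append, List.mem_singleton] at hw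
      rcases hw with hw | rfl
      · exact ⟨(show w i < c from hA w hw).le, hS w hw⟩
      · exact ⟨hzc.le, W.snd_mem_support_of_mem_edges hlast⟩
    · rw [Walk.edges_concat, List.concat_eq_append, List.mem_append, List.mem_singleton] at he
      rcases he with he | rfl
      · exact hE e he
      · exact hlast

/-- **Prefix down to a level** (mirror image): from `x_i ≥ c` to `x_i ≤ c`, an initial segment
ends on `{x_i = c}` and stays in `{x_i ≥ c}`. [folklore] -/
theorem exists_prefix_reach_le (i : Fin 2) (W : (zdGraph 2).Walk a b) (c : ℤ) (ha : c ≤ a i)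
    (hb : b i ≤ c) :
    ∃ (q : Site 2) (U : (zdGraph 2).Walk a q), q i = c ∧
      (∀ z ∈ U.support, c ≤ z i ∧ z ∈ W.support) ∧ ∀ e ∈ U.edges, e ∈ W.edges := by
  rcases eq_or_lt_of_le ha with hac | hac
  · exact ⟨a, Walk.nil, hac.symm, fun z hz => by
      rw [Walk.support_nil, List.mem_singleton] at hz; subst hz; exact ⟨ha, W.start_mem_support⟩,
      fun e he => by simp at he⟩
  · obtain ⟨x, z, q₁, hxz, hz, hA, hS, hE, hlast⟩ :=
      exists_prefix_exit (A := {x : Site 2 | c < x i}) W hac (not_lt.2 hb)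
    have hzc : z i = c := by
      have h1 : c < x i := hA x q₁.end_mem_support
      have h2 : ¬ c < z i := hz
      have := zdGraph_adj_apply_le hxz i
      omega
    refine ⟨z, q₁.concat hxz, hzc, fun w hw => ?_, fun e he => ?_⟩
    · rw [Walk.support_concat, List.mem_append, List.mem_singleton] at hw
      rcases hw with hw | rfl
      · exact ⟨(show c < w i from hA w hw).le, hS w hw⟩
      · exact ⟨hzc.ge, W.snd_mem_support_of_mem_edges hlast⟩
    · rw [Walk.edges_concat, List.concat_eq_append, List.mem_append, List.mem_singleton] at he
      rcases he with he | rfl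
      · exact hE e he
      · exact hlast

/-- **A segment between two levels.** If a lattice walk starts with `x_i ≤ lo` and ends with
`x_i ≥ hi` (`lo ≤ hi`), some segment of it (vertices and edges of the walk) runs from the level
`{x_i = lo}` to the level `{x_i = hi}` inside the slab `{lo ≤ x_i ≤ hi}`. [folklore] -/
theorem exists_segment_between (i : Fin 2) (W : (zdGraph 2).Walk a b) (lo hi : ℤ) (ha : a i ≤ lo)
    (hb : hi ≤ b i) (hlh : lo ≤ hi) :
    ∃ (p q : Site 2) (U : (zdGraph 2).Walk p q), p i = lo ∧ q i = hi ∧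
      (∀ z ∈ U.support, lo ≤ z i ∧ z i ≤ hi ∧ z ∈ W.support) ∧ ∀ e ∈ U.edges, e ∈ W.edges := by
  obtain ⟨q, U₁, hq, hU₁s, hU₁e⟩ := exists_prefix_reach_ge i W hi (ha.trans hlh) hb
  obtain ⟨p, U₂, hp, hU₂s, hU₂e⟩ :=
    exists_prefix_reach_le i U₁.reverse lo (by rw [hq]; exact hlh) ha
  refine ⟨p, q, U₂.reverse, hp, hq, fun z hz => ?_, fun e he => ?_⟩
  · rw [Walk.support_reverse, List.mem_reverse] at hz
    obtain ⟨h1, h2⟩ := hU₂s z hz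
    rw [Walk.support_reverse, List.mem_reverse] at h2
    exact ⟨h1, (hU₁s z h2).1, (hU₁s z h2).2⟩
  · rw [Walk.edges_reverse, List.mem_reverse] at he
    have := hU₂e e he
    rw [Walk.edges_reverse, List.mem_reverse] at this
    exact hU₁e e this

/-- **A band-crossing meets a fence crossing, vertical fence.** Let `V` be a lattice walk inside
the columns `[L, R]` from a row `≤ B₀` to a row `≥ B₁` (`B₀ ≤ B₁`), and `T` a lattice walk inside
the box `[L, R] × [B₀, B₁]` from its left column to its right column. Then `T` and `V` share a
vertex. [folklore] -/
theorem exists_mem_support_of_vFence {c d s y : Site 2} {L R B₀ B₁ : ℤ} (V : (zdGraph 2).Walk c d)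
    (hV : ∀ z ∈ V.support, L ≤ z 0 ∧ z 0 ≤ R) (hc : c 1 ≤ B₀) (hd : B₁ ≤ d 1) (hB : B₀ ≤ B₁)
    (T : (zdGraph 2).Walk s y) (hs : s 0 = L) (hy : y 0 = R)
    (hT : ∀ z ∈ T.support, L ≤ z 0 ∧ z 0 ≤ R ∧ B₀ ≤ z 1 ∧ z 1 ≤ B₁) :
    ∃ m ∈ T.support, m ∈ V.support := by
  obtain ⟨p, q, U, hp, hq, hUs, -⟩ := exists_segment_between 1 V B₀ B₁ hc hd hB
  obtain ⟨m, hmT, hmU⟩ := exists_mem_support_of_crossing (L := L) (R := R) (B := B₀) (T := B₁) T U hT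
    (fun z hz => ⟨(hV z (hUs z hz).2.2).1, (hV z (hUs z hz).2.2).2, (hUs z hz).1, (hUs z hz).2.1⟩)
    hs hy hp hq
  exact ⟨m, hmT, (hUs m hmU).2.2⟩

/-- **A band-crossing meets a fence crossing, horizontal fence** (transposed): `C` is a lattice walk
inside the rows `[B, B']` from a column `≤ L₀` to a column `≥ L₁` (`L₀ ≤ L₁`), and `T` a lattice walk
inside `[L₀, L₁] × [B, B']` from its bottom row to its top row. Then `T` and `C` share a vertex.
[folklore] -/
theorem exists_mem_support_of_hFence {c d s y : Site 2} {L₀ L₁ B B' : ℤ} (C : (zdGraph 2).Walk c d)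
    (hC : ∀ z ∈ C.support, B ≤ z 1 ∧ z 1 ≤ B') (hc : c 0 ≤ L₀) (hd : L₁ ≤ d 0) (hL : L₀ ≤ L₁)
    (T : (zdGraph 2).Walk s y) (hs : s 1 = B) (hy : y 1 = B')
    (hT : ∀ z ∈ T.support, L₀ ≤ z 0 ∧ z 0 ≤ L₁ ∧ B ≤ z 1 ∧ z 1 ≤ B') :
    ∃ m ∈ T.support, m ∈ C.support := by
  obtain ⟨p, q, U, hp, hq, hUs, -⟩ := exists_segment_between 0 C L₀ L₁ hc hd hL
  obtain ⟨m, hmU, hmT⟩ := exists_mem_support_of_crossing (L := L₀) (R := L₁) (B := B) (T := B') U T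
    (fun z hz => ⟨(hUs z hz).1, (hUs z hz).2.1, (hC z (hUs z hz).2.2).1, (hC z (hUs z hz).2.2).2⟩)
    hT hp hq hs hy
  exact ⟨m, hmT, (hUs m hmU).2.2⟩

/-- A walk inside `V` between two of its vertices (through its start). [folklore] -/
theorem exists_walk_within_support {c d u m : Site 2} (V : (zdGraph 2).Walk c d) (hu : u ∈ V.support)
    (hm : m ∈ V.support) :
    ∃ U : (zdGraph 2).Walk u m, (∀ z ∈ U.support, z ∈ V.support) ∧ ∀ e ∈ U.edges, e ∈ V.edges := by
  classical
  refine ⟨(V.takeUntil u hu).reverse.append (V.takeUntil m hm), fun z hz => ?_, fun e he => ?_⟩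
  · rw [Walk.mem_support_append_iff, Walk.support_reverse, List.mem_reverse] at hz
    rcases hz with hz | hz
    · exact V.support_takeUntil_subset_support hu hz
    · exact V.support_takeUntil_subset_support hm hz
  · rw [Walk.edges_append, List.mem_append, Walk.edges_reverse, List.mem_reverse] at he
    rcases he with he | he
    · exact V.edges_takeUntil_subset_edges hu he
    · exact V.edges_takeUntil_subset_edges hm he

end Surgery

/-! ### Gluing a corridor crossing to a fenced open arm -/

section GlueOpen

variable {ω : BondConfig (Site 2)} {n N : ℕ} {lo hi lo' hi' B₀ : ℤ} {s y : Site 2}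

/-- **Outer gluing, right arm.** Let `A` be a fenced right arm whose outer landing heights are
`[B₀, B₀ + N/64]` and let `T` be an open walk starting on the column `{x₀ = N + 1}`, staying in
`{x₀ ≥ N + 1}`, reaching the column `{x₀ ≥ N + N/8}`, and lying in the band
`{B₀ ≤ x₁ ≤ B₀ + N/64}` as long as `x₀ ≤ N + N/8` (a crossing of the corridor attached to the fence
box).  Then some vertex of `T` is joined to the inner endpoint of the arm by an open walk inside
the carrier of the arm (body, attaching walk, fence crossing: the crossing of the corridor meets
the fence crossing, `exists_mem_support_of_crossing`).  (Nolin 2008, proof of Prop. 12: "the free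
spaces allow to extend the arms"; Kesten 1987, (2.43).) [cite: Nolin2008, §4.3, proof of Prop. 12 (arXiv 0711.4948: Prop. 11)] -/
theorem ZdSepOpenArmR.exists_walk_of_outerCorridor (A : ZdSepOpenArmR ω n N lo hi B₀ (B₀ + (N / 64 : ℕ)))
    (hE : 1 ≤ N / 8) (T : (zdGraph 2).Walk s y) (hs : s 0 = N + 1) (hy : (N : ℤ) + (N / 8 : ℕ) ≤ y 0)
    (hT : ∀ z ∈ T.support, (N : ℤ) + 1 ≤ z 0 ∧ (z 0 ≤ N + (N / 8 : ℕ) → B₀ ≤ z 1 ∧ z 1 ≤ B₀ + (N / 64 : ℕ))) :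
    ∃ m ∈ T.support, ∃ U : (zdGraph 2).Walk A.x m,
      (∀ z ∈ U.support, z ∈ A.carrier) ∧ ∀ e ∈ U.edges, e ∈ ω := by
  obtain ⟨q, T₁, hq, hT₁s, -⟩ := exists_prefix_reach_ge 0 T ((N : ℤ) + (N / 8 : ℕ)) (by rw [hs]; omega) hy
  have hbox : ∀ z ∈ T₁.support, (N : ℤ) + 1 ≤ z 0 ∧ z 0 ≤ N + (N / 8 : ℕ) ∧ B₀ ≤ z 1 ∧ z 1 ≤ B₀ + (N / 64 : ℕ) := by
    intro z hz
    obtain ⟨h1, h2⟩ := hT₁s z hz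
    obtain ⟨h3, h4⟩ := hT z h2
    exact ⟨h3, h1, h4 h1⟩
  have hz := A.hz
  obtain ⟨m, hmT, hmV⟩ := exists_mem_support_of_vFence (L := (N : ℤ) + 1) (R := (N : ℤ) + (N / 8 : ℕ))
    (B₀ := B₀) (B₁ := B₀ + (N / 64 : ℕ)) A.V (fun z hz => ⟨(A.hV z hz).1, (A.hV z hz).2.1⟩)
    (by rw [A.hab.1]; omega) (by rw [A.hab.2]; omega) (by omega) T₁ hs hq hbox
  obtain ⟨Uv, hUvs, hUve⟩ := exists_walk_within_support A.V A.hu hmV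
  refine ⟨m, (hT₁s m hmT).2, A.W.append (A.P.append Uv), fun z hz => ?_, fun e he => ?_⟩
  · rw [Walk.mem_support_append_iff, Walk.mem_support_append_iff] at hz
    rcases hz with hz | hz | hz
    · exact Or.inl hz
    · exact Or.inr (Or.inr (Or.inl hz))
    · exact Or.inr (Or.inl (hUvs z hz))
  · rw [Walk.edges_append, List.mem_append, Walk.edges_append, List.mem_append] at he
    rcases he with he | he | he
    · exact A.hWo e he
    · exact A.hPo e he
    · exact A.hVo e (hUve e he)

/-- **Inner gluing, right arm.** Let `A` be a fenced right arm whose inner landing heights are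
`[B₀, B₀ + n/64]` and let `T` be an open walk ending on the column `{x₀ = n - 1}`, staying in
`{x₀ ≤ n - 1}`, starting in `{x₀ ≤ n - n/8}`, and lying in the band `{B₀ ≤ x₁ ≤ B₀ + n/64}` as long
as `x₀ ≥ n - n/8`.  Then some vertex of `T` is joined to the inner endpoint of the arm by an open
walk inside the carrier (inner attaching walk and inner fence crossing). [cite: Nolin2008, §4.3, proof of Prop. 12 (arXiv 0711.4948: Prop. 11)] -/
theorem ZdSepOpenArmR.exists_walk_of_innerCorridor (A : ZdSepOpenArmR ω n N B₀ (B₀ + (n / 64 : ℕ)) lo' hi')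
    (he : 1 ≤ n / 8) (T : (zdGraph 2).Walk s y) (hy : y 0 + 1 = n) (hs : s 0 ≤ (n : ℤ) - (n / 8 : ℕ))
    (hT : ∀ z ∈ T.support, z 0 + 1 ≤ n ∧ ((n : ℤ) - (n / 8 : ℕ) ≤ z 0 → B₀ ≤ z 1 ∧ z 1 ≤ B₀ + (n / 64 : ℕ))) :
    ∃ m ∈ T.support, ∃ U : (zdGraph 2).Walk A.x m,
      (∀ z ∈ U.support, z ∈ A.carrier) ∧ ∀ e ∈ U.edges, e ∈ ω := by
  obtain ⟨q, T₁, hq, hT₁s, -⟩ :=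
    exists_prefix_reach_le 0 T.reverse ((n : ℤ) - (n / 8 : ℕ)) (by omega) hs
  have hbox : ∀ z ∈ T₁.reverse.support, (n : ℤ) - (n / 8 : ℕ) ≤ z 0 ∧ z 0 ≤ (n : ℤ) - 1 ∧
      B₀ ≤ z 1 ∧ z 1 ≤ B₀ + (n / 64 : ℕ) := by
    intro z hz
    rw [Walk.support_reverse, List.mem_reverse] at hz
    obtain ⟨h1, h2⟩ := hT₁s z hz
    rw [Walk.support_reverse, List.mem_reverse] at h2
    obtain ⟨h3, h4⟩ := hT z h2
    exact ⟨h1, by omega, h4 h1⟩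
  have hx := A.hx
  obtain ⟨m, hmT, hmV⟩ := exists_mem_support_of_vFence (L := (n : ℤ) - (n / 8 : ℕ)) (R := (n : ℤ) - 1)
    (B₀ := B₀) (B₁ := B₀ + (n / 64 : ℕ)) A.V' (fun z hz => ⟨(A.hV' z hz).1, by have := (A.hV' z hz).2.1; omega⟩)
    (by rw [A.hab'.1]; omega) (by rw [A.hab'.2]; omega) (by omega) T₁.reverse hq (by omega) hbox
  obtain ⟨Uv, hUvs, hUve⟩ := exists_walk_within_support A.V' A.hu' hmV
  have hmT' : m ∈ T.support := by
    rw [Walk.support_reverse, List.mem_reverse] at hmT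
    have := (hT₁s m hmT).2
    rwa [Walk.support_reverse, List.mem_reverse] at this
  refine ⟨m, hmT', A.P'.append Uv, fun z hz => ?_, fun e he => ?_⟩
  · rw [Walk.mem_support_append_iff] at hz
    rcases hz with hz | hz
    · exact Or.inr (Or.inr (Or.inr (Or.inr hz)))
    · exact Or.inr (Or.inr (Or.inr (Or.inl (hUvs z hz))))
  · rw [Walk.edges_append, List.mem_append] at he
    rcases he with he | he
    · exact A.hP'o e he
    · exact A.hV'o e (hUve e he)

/-- **Outer gluing, left arm** (mirror image of `ZdSepOpenArmR.exists_walk_of_outerCorridor`): the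
corridor crossing starts on the column `{x₀ = -N - 1}`, stays in `{x₀ ≤ -N - 1}`, reaches
`{x₀ ≤ -N - N/8}` and lies in the band while `x₀ ≥ -N - N/8`. [cite: Nolin2008, §4.3, proof of Prop. 12 (arXiv 0711.4948: Prop. 11)] -/
theorem ZdSepOpenArmL.exists_walk_of_outerCorridor (A : ZdSepOpenArmL ω n N lo hi B₀ (B₀ + (N / 64 : ℕ)))
    (hE : 1 ≤ N / 8) (T : (zdGraph 2).Walk s y) (hs : s 0 = -(N : ℤ) - 1) (hy : y 0 ≤ -(N : ℤ) - (N / 8 : ℕ))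
    (hT : ∀ z ∈ T.support, z 0 ≤ -(N : ℤ) - 1 ∧ (-(N : ℤ) - (N / 8 : ℕ) ≤ z 0 → B₀ ≤ z 1 ∧ z 1 ≤ B₀ + (N / 64 : ℕ))) :
    ∃ m ∈ T.support, ∃ U : (zdGraph 2).Walk A.x m,
      (∀ z ∈ U.support, z ∈ A.carrier) ∧ ∀ e ∈ U.edges, e ∈ ω := by
  obtain ⟨q, T₁, hq, hT₁s, -⟩ := exists_prefix_reach_le 0 T (-(N : ℤ) - (N / 8 : ℕ)) (by rw [hs]; omega) hy
  have hbox : ∀ z ∈ T₁.reverse.support, -(N : ℤ) - (N / 8 : ℕ) ≤ z 0 ∧ z 0 ≤ -(N : ℤ) - 1 ∧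
      B₀ ≤ z 1 ∧ z 1 ≤ B₀ + (N / 64 : ℕ) := by
    intro z hz
    rw [Walk.support_reverse, List.mem_reverse] at hz
    obtain ⟨h1, h2⟩ := hT₁s z hz
    obtain ⟨h3, h4⟩ := hT z h2
    exact ⟨h1, h3, h4 h1⟩
  have hz := A.hz
  obtain ⟨m, hmT, hmV⟩ := exists_mem_support_of_vFence (L := -(N : ℤ) - (N / 8 : ℕ)) (R := -(N : ℤ) - 1)
    (B₀ := B₀) (B₁ := B₀ + (N / 64 : ℕ)) A.V
    (fun z hz => ⟨by have := (A.hV z hz).1; omega, by have := (A.hV z hz).2.1; omega⟩)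
    (by rw [A.hab.1]; omega) (by rw [A.hab.2]; omega) (by omega) T₁.reverse hq hs hbox
  obtain ⟨Uv, hUvs, hUve⟩ := exists_walk_within_support A.V A.hu hmV
  have hmT' : m ∈ T.support := by
    rw [Walk.support_reverse, List.mem_reverse] at hmT
    exact (hT₁s m hmT).2
  refine ⟨m, hmT', A.W.append (A.P.append Uv), fun z hz => ?_, fun e he => ?_⟩
  · rw [Walk.mem_support_append_iff, Walk.mem_support_append_iff] at hz
    rcases hz with hz | hz | hz
    · exact Or.inl hz
    · exact Or.inr (Or.inr (Or.inl hz))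
    · exact Or.inr (Or.inl (hUvs z hz))
  · rw [Walk.edges_append, List.mem_append, Walk.edges_append, List.mem_append] at he
    rcases he with he | he | he
    · exact A.hWo e he
    · exact A.hPo e he
    · exact A.hVo e (hUve e he)

/-- **Inner gluing, left arm** (mirror image of `ZdSepOpenArmR.exists_walk_of_innerCorridor`): the
corridor crossing ends on the column `{x₀ = -n + 1}`, stays in `{x₀ ≥ -n + 1}`, starts in
`{x₀ ≥ -n + n/8}` and lies in the band while `x₀ ≤ -n + n/8`. [cite: Nolin2008, §4.3, proof of Prop. 12 (arXiv 0711.4948: Prop. 11)] -/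
theorem ZdSepOpenArmL.exists_walk_of_innerCorridor (A : ZdSepOpenArmL ω n N B₀ (B₀ + (n / 64 : ℕ)) lo' hi')
    (he : 1 ≤ n / 8) (T : (zdGraph 2).Walk s y) (hy : y 0 = -(n : ℤ) + 1) (hs : -(n : ℤ) + (n / 8 : ℕ) ≤ s 0)
    (hT : ∀ z ∈ T.support, -(n : ℤ) + 1 ≤ z 0 ∧ (z 0 ≤ -(n : ℤ) + (n / 8 : ℕ) → B₀ ≤ z 1 ∧ z 1 ≤ B₀ + (n / 64 : ℕ))) :
    ∃ m ∈ T.support, ∃ U : (zdGraph 2).Walk A.x m,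
      (∀ z ∈ U.support, z ∈ A.carrier) ∧ ∀ e ∈ U.edges, e ∈ ω := by
  obtain ⟨q, T₁, hq, hT₁s, -⟩ :=
    exists_prefix_reach_ge 0 T.reverse (-(n : ℤ) + (n / 8 : ℕ)) (by rw [hy]; omega) hs
  have hbox : ∀ z ∈ T₁.support, -(n : ℤ) + 1 ≤ z 0 ∧ z 0 ≤ -(n : ℤ) + (n / 8 : ℕ) ∧
      B₀ ≤ z 1 ∧ z 1 ≤ B₀ + (n / 64 : ℕ) := by
    intro z hz
    obtain ⟨h1, h2⟩ := hT₁s z hz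
    rw [Walk.support_reverse, List.mem_reverse] at h2
    obtain ⟨h3, h4⟩ := hT z h2
    exact ⟨h3, h1, h4 h1⟩
  have hx := A.hx
  obtain ⟨m, hmT, hmV⟩ := exists_mem_support_of_vFence (L := -(n : ℤ) + 1) (R := -(n : ℤ) + (n / 8 : ℕ))
    (B₀ := B₀) (B₁ := B₀ + (n / 64 : ℕ)) A.V' (fun z hz => ⟨(A.hV' z hz).1, (A.hV' z hz).2.1⟩)
    (by rw [A.hab'.1]; omega) (by rw [A.hab'.2]; omega) (by omega) T₁ hy hq hbox
  obtain ⟨Uv, hUvs, hUve⟩ := exists_walk_within_support A.V' A.hu' hmV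
  have hmT' : m ∈ T.support := by
    have := (hT₁s m hmT).2
    rwa [Walk.support_reverse, List.mem_reverse] at this
  refine ⟨m, hmT', A.P'.append Uv, fun z hz => ?_, fun e he => ?_⟩
  · rw [Walk.mem_support_append_iff] at hz
    rcases hz with hz | hz
    · exact Or.inr (Or.inr (Or.inr (Or.inr hz)))
    · exact Or.inr (Or.inr (Or.inr (Or.inl (hUvs z hz))))
  · rw [Walk.edges_append, List.mem_append] at he
    rcases he with he | he
    · exact A.hP'o e he
    · exact A.hV'o e (hUve e he)

end GlueOpen

/-! ### Gluing a dual corridor crossing to a fenced dual arm -/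

section GlueDual

variable {ω : BondConfig (Site 2)} {n N : ℕ} {lo hi lo' hi' B₀ : ℤ} {s y : Site 2}

/-- The edge crossed by the reversed dart is the same edge. [folklore] -/
theorem sepEdge_dart_symm (d : (zdGraph 2).Dart) : sepEdge d.symm.fst d.symm.snd = sepEdge d.fst d.snd := by
  rw [sepEdge_comm]; rfl

/-- A walk inside the face walk `C` between two of its faces whose steps are steps of `C` or their
reversals. [folklore] -/
theorem exists_faceWalk_within_support {c d u m : Site 2} (C : (zdGraph 2).Walk c d) (hu : u ∈ C.support)
    (hm : m ∈ C.support) :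
    ∃ U : (zdGraph 2).Walk u m, (∀ z ∈ U.support, z ∈ C.support) ∧
      ∀ e ∈ U.darts, e ∈ C.darts ∨ e.symm ∈ C.darts := by
  classical
  refine ⟨(C.takeUntil u hu).reverse.append (C.takeUntil m hm), fun z hz => ?_, fun e he => ?_⟩
  · rw [Walk.mem_support_append_iff, Walk.support_reverse, List.mem_reverse] at hz
    rcases hz with hz | hz
    · exact C.support_takeUntil_subset_support hu hz
    · exact C.support_takeUntil_subset_support hm hz
  · rw [Walk.darts_append, List.mem_append, Walk.darts_reverse, List.mem_reverse, List.mem_map] at he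
    rcases he with ⟨e', he', rfl⟩ | he
    · right
      rw [Dart.symm_symm]
      exact C.darts_takeUntil_subset_darts hu he'
    · exact Or.inl (C.darts_takeUntil_subset_darts hm he)

/-- **Outer gluing, top dual arm.** Let `A` be a fenced top dual arm whose outer landing columns
are `[B₀, B₀ + N/64]` and `T` a walk of faces starting on the face row `{x₁ = N + 1}`, staying in
`{x₁ ≥ N + 1}`, reaching `{x₁ ≥ N + N/8}` and lying in the column band `{B₀ ≤ x₀ ≤ B₀ + N/64}` as
long as `x₁ ≤ N + N/8` (a dual crossing of the corridor above the fence box).  Then some face of `T`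
is joined to the start face of the arm by a walk of faces of the arm's body, attaching walk and
fence crossing — all of whose steps cross CLOSED edges lying in the annulus or among the fence
sites. [cite: Nolin2008, §4.3, proof of Prop. 12 (arXiv 0711.4948: Prop. 11)] -/
theorem ZdSepDualArmT.exists_faceWalk_of_outerCorridor
    (A : ZdSepDualArmT ω n N lo hi B₀ (B₀ + (N / 64 : ℕ))) (hE : 1 ≤ N / 8)
    (T : (zdGraph 2).Walk s y) (hs : s 1 = N + 1) (hy : (N : ℤ) + (N / 8 : ℕ) ≤ y 1)
    (hT : ∀ z ∈ T.support, (N : ℤ) + 1 ≤ z 1 ∧ (z 1 ≤ N + (N / 8 : ℕ) → B₀ ≤ z 0 ∧ z 0 ≤ B₀ + (N / 64 : ℕ))) :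
    ∃ m ∈ T.support, ∃ U : (zdGraph 2).Walk A.f m,
      (∀ z ∈ U.support, z ∈ A.Q.support ∨ z ∈ A.P.support ∨ z ∈ A.C.support) ∧
      (∀ d ∈ U.darts, sepEdge d.fst d.snd ∉ ω) ∧
      (∀ d ∈ U.darts, ∀ v ∈ sepEdge d.fst d.snd, v ∈ sqAnnulus n N ∪ A.fenceSites) := by
  obtain ⟨q, T₁, hq, hT₁s, -⟩ := exists_prefix_reach_ge 1 T ((N : ℤ) + (N / 8 : ℕ)) (by rw [hs]; omega) hy
  have hbox : ∀ z ∈ T₁.support, B₀ ≤ z 0 ∧ z 0 ≤ B₀ + (N / 64 : ℕ) ∧ (N : ℤ) + 1 ≤ z 1 ∧ z 1 ≤ N + (N / 8 : ℕ) := by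
    intro z hz
    obtain ⟨h1, h2⟩ := hT₁s z hz
    obtain ⟨h3, h4⟩ := hT z h2
    exact ⟨(h4 h1).1, (h4 h1).2, h3, h1⟩
  have hg := A.hg
  obtain ⟨m, hmT, hmC⟩ := exists_mem_support_of_hFence (L₀ := B₀) (L₁ := B₀ + (N / 64 : ℕ))
    (B := (N : ℤ) + 1) (B' := (N : ℤ) + (N / 8 : ℕ)) A.C (fun z hz => ⟨(A.hC z hz).2.1, (A.hC z hz).2.2⟩)
    (by rw [A.hab.1]; omega) (by rw [A.hab.2]; omega) (by omega) T₁ hs hq hbox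
  obtain ⟨Uc, hUcs, hUcd⟩ := exists_faceWalk_within_support A.C A.hu hmC
  have hCd : ∀ d ∈ Uc.darts, sepEdge d.fst d.snd ∉ ω ∧ ∃ d' ∈ A.C.darts, sepEdge d.fst d.snd = sepEdge d'.fst d'.snd := by
    intro d hd
    rcases hUcd d hd with h | h
    · exact ⟨A.hCc d h, d, h, rfl⟩
    · refine ⟨?_, d.symm, h, (sepEdge_dart_symm d).symm⟩
      rw [← sepEdge_dart_symm]; exact A.hCc _ h
  refine ⟨m, (hT₁s m hmT).2, A.Q.append (A.P.append Uc), fun z hz => ?_, fun d hd => ?_, fun d hd v hv => ?_⟩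
  · rw [Walk.mem_support_append_iff, Walk.mem_support_append_iff] at hz
    rcases hz with hz | hz | hz
    · exact Or.inl hz
    · exact Or.inr (Or.inl hz)
    · exact Or.inr (Or.inr (hUcs z hz))
  · rw [Walk.darts_append, List.mem_append, Walk.darts_append, List.mem_append] at hd
    rcases hd with hd | hd | hd
    · exact A.hQc d hd
    · exact A.hPc d hd
    · exact (hCd d hd).1
  · rw [Walk.darts_append, List.mem_append, Walk.darts_append, List.mem_append] at hd
    rcases hd with hd | hd | hd
    · exact Or.inl (A.hQa d hd v hv)
    · exact Or.inr (Or.inr (Or.inl ⟨d, hd, hv⟩))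
    · obtain ⟨-, d', hd', heq⟩ := hCd d hd
      exact Or.inr (Or.inl ⟨d', hd', heq ▸ hv⟩)

/-- **Inner gluing, top dual arm.** The inner landing columns are `[B₀, B₀ + n/64]`; the dual
corridor crossing `T` ends on the face row `{x₁ = n - 2}` (the top row of the inner fence box),
stays in `{x₁ ≤ n - 2}`, starts in `{x₁ ≤ n - 1 - n/8}` and lies in the column band while
`x₁ ≥ n - 1 - n/8`.  Some face of `T` is joined to the start face of the arm through the inner
attaching walk and inner fence crossing, across closed edges among the fence sites. [cite: Nolin2008, §4.3, proof of Prop. 12 (arXiv 0711.4948: Prop. 11)] -/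
theorem ZdSepDualArmT.exists_faceWalk_of_innerCorridor
    (A : ZdSepDualArmT ω n N B₀ (B₀ + (n / 64 : ℕ)) lo' hi') (he : 1 ≤ n / 8)
    (T : (zdGraph 2).Walk s y) (hy : y 1 + 2 = n) (hs : s 1 ≤ (n : ℤ) - 1 - (n / 8 : ℕ))
    (hT : ∀ z ∈ T.support, z 1 + 2 ≤ n ∧ ((n : ℤ) - 1 - (n / 8 : ℕ) ≤ z 1 → B₀ ≤ z 0 ∧ z 0 ≤ B₀ + (n / 64 : ℕ))) :
    ∃ m ∈ T.support, ∃ U : (zdGraph 2).Walk A.f m,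
      (∀ z ∈ U.support, z ∈ A.P'.support ∨ z ∈ A.C'.support) ∧
      (∀ d ∈ U.darts, sepEdge d.fst d.snd ∉ ω) ∧
      (∀ d ∈ U.darts, ∀ v ∈ sepEdge d.fst d.snd, v ∈ A.fenceSites) := by
  obtain ⟨q, T₁, hq, hT₁s, -⟩ :=
    exists_prefix_reach_le 1 T.reverse ((n : ℤ) - 1 - (n / 8 : ℕ)) (by omega) hs
  have hbox : ∀ z ∈ T₁.reverse.support, B₀ ≤ z 0 ∧ z 0 ≤ B₀ + (n / 64 : ℕ) ∧
      (n : ℤ) - 1 - (n / 8 : ℕ) ≤ z 1 ∧ z 1 ≤ (n : ℤ) - 2 := by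
    intro z hz
    rw [Walk.support_reverse, List.mem_reverse] at hz
    obtain ⟨h1, h2⟩ := hT₁s z hz
    rw [Walk.support_reverse, List.mem_reverse] at h2
    obtain ⟨h3, h4⟩ := hT z h2
    exact ⟨(h4 h1).1, (h4 h1).2, h1, by omega⟩
  have hf := A.hf
  obtain ⟨m, hmT, hmC⟩ := exists_mem_support_of_hFence (L₀ := B₀) (L₁ := B₀ + (n / 64 : ℕ))
    (B := (n : ℤ) - 1 - (n / 8 : ℕ)) (B' := (n : ℤ) - 2) A.C'
    (fun z hz => ⟨(A.hC' z hz).2.1, by have := (A.hC' z hz).2.2; omega⟩)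
    (by rw [A.hab'.1]; omega) (by rw [A.hab'.2]; omega) (by omega) T₁.reverse hq (by omega) hbox
  obtain ⟨Uc, hUcs, hUcd⟩ := exists_faceWalk_within_support A.C' A.hu' hmC
  have hCd : ∀ d ∈ Uc.darts, sepEdge d.fst d.snd ∉ ω ∧ ∃ d' ∈ A.C'.darts, sepEdge d.fst d.snd = sepEdge d'.fst d'.snd := by
    intro d hd
    rcases hUcd d hd with h | h
    · exact ⟨A.hC'c d h, d, h, rfl⟩
    · refine ⟨?_, d.symm, h, (sepEdge_dart_symm d).symm⟩
      rw [← sepEdge_dart_symm]; exact A.hC'c _ h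
  have hmT' : m ∈ T.support := by
    rw [Walk.support_reverse, List.mem_reverse] at hmT
    have := (hT₁s m hmT).2
    rwa [Walk.support_reverse, List.mem_reverse] at this
  refine ⟨m, hmT', A.P'.append Uc, fun z hz => ?_, fun d hd => ?_, fun d hd v hv => ?_⟩
  · rw [Walk.mem_support_append_iff] at hz
    rcases hz with hz | hz
    · exact Or.inl hz
    · exact Or.inr (hUcs z hz)
  · rw [Walk.darts_append, List.mem_append] at hd
    rcases hd with hd | hd
    · exact A.hP'c d hd
    · exact (hCd d hd).1
  · rw [Walk.darts_append, List.mem_append] at hd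
    rcases hd with hd | hd
    · exact Or.inr (Or.inr (Or.inr ⟨d, hd, hv⟩))
    · obtain ⟨-, d', hd', heq⟩ := hCd d hd
      exact Or.inr (Or.inr (Or.inl ⟨d', hd', heq ▸ hv⟩))

/-- **Outer gluing, bottom dual arm** (mirror image): the dual corridor crossing starts on the face
row `{x₁ = -N - 2}`, stays in `{x₁ ≤ -N - 2}`, reaches `{x₁ ≤ -N - 1 - N/8}` and lies in the
column band while `x₁ ≥ -N - 1 - N/8`. [cite: Nolin2008, §4.3, proof of Prop. 12 (arXiv 0711.4948: Prop. 11)] -/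
theorem ZdSepDualArmB.exists_faceWalk_of_outerCorridor
    (A : ZdSepDualArmB ω n N lo hi B₀ (B₀ + (N / 64 : ℕ))) (hE : 1 ≤ N / 8)
    (T : (zdGraph 2).Walk s y) (hs : s 1 + 2 = -(N : ℤ)) (hy : y 1 ≤ -(N : ℤ) - 1 - (N / 8 : ℕ))
    (hT : ∀ z ∈ T.support, z 1 + 2 ≤ -(N : ℤ) ∧ (-(N : ℤ) - 1 - (N / 8 : ℕ) ≤ z 1 → B₀ ≤ z 0 ∧ z 0 ≤ B₀ + (N / 64 : ℕ))) :
    ∃ m ∈ T.support, ∃ U : (zdGraph 2).Walk A.f m,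
      (∀ z ∈ U.support, z ∈ A.Q.support ∨ z ∈ A.P.support ∨ z ∈ A.C.support) ∧
      (∀ d ∈ U.darts, sepEdge d.fst d.snd ∉ ω) ∧
      (∀ d ∈ U.darts, ∀ v ∈ sepEdge d.fst d.snd, v ∈ sqAnnulus n N ∪ A.fenceSites) := by
  obtain ⟨q, T₁, hq, hT₁s, -⟩ :=
    exists_prefix_reach_le 1 T (-(N : ℤ) - 1 - (N / 8 : ℕ)) (by omega) hy
  have hbox : ∀ z ∈ T₁.reverse.support, B₀ ≤ z 0 ∧ z 0 ≤ B₀ + (N / 64 : ℕ) ∧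
      -(N : ℤ) - 1 - (N / 8 : ℕ) ≤ z 1 ∧ z 1 ≤ -(N : ℤ) - 2 := by
    intro z hz
    rw [Walk.support_reverse, List.mem_reverse] at hz
    obtain ⟨h1, h2⟩ := hT₁s z hz
    obtain ⟨h3, h4⟩ := hT z h2
    exact ⟨(h4 h1).1, (h4 h1).2, h1, by omega⟩
  have hg := A.hg
  obtain ⟨m, hmT, hmC⟩ := exists_mem_support_of_hFence (L₀ := B₀) (L₁ := B₀ + (N / 64 : ℕ))
    (B := -(N : ℤ) - 1 - (N / 8 : ℕ)) (B' := -(N : ℤ) - 2) A.C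
    (fun z hz => ⟨by have := (A.hC z hz).2.1; omega, by have := (A.hC z hz).2.2; omega⟩)
    (by rw [A.hab.1]; omega) (by rw [A.hab.2]; omega) (by omega) T₁.reverse hq (by omega) hbox
  obtain ⟨Uc, hUcs, hUcd⟩ := exists_faceWalk_within_support A.C A.hu hmC
  have hCd : ∀ d ∈ Uc.darts, sepEdge d.fst d.snd ∉ ω ∧ ∃ d' ∈ A.C.darts, sepEdge d.fst d.snd = sepEdge d'.fst d'.snd := by
    intro d hd
    rcases hUcd d hd with h | h
    · exact ⟨A.hCc d h, d, h, rfl⟩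
    · refine ⟨?_, d.symm, h, (sepEdge_dart_symm d).symm⟩
      rw [← sepEdge_dart_symm]; exact A.hCc _ h
  have hmT' : m ∈ T.support := by
    rw [Walk.support_reverse, List.mem_reverse] at hmT
    exact (hT₁s m hmT).2
  refine ⟨m, hmT', A.Q.append (A.P.append Uc), fun z hz => ?_, fun d hd => ?_, fun d hd v hv => ?_⟩
  · rw [Walk.mem_support_append_iff, Walk.mem_support_append_iff] at hz
    rcases hz with hz | hz | hz
    · exact Or.inl hz
    · exact Or.inr (Or.inl hz)
    · exact Or.inr (Or.inr (hUcs z hz))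
  · rw [Walk.darts_append, List.mem_append, Walk.darts_append, List.mem_append] at hd
    rcases hd with hd | hd | hd
    · exact A.hQc d hd
    · exact A.hPc d hd
    · exact (hCd d hd).1
  · rw [Walk.darts_append, List.mem_append, Walk.darts_append, List.mem_append] at hd
    rcases hd with hd | hd | hd
    · exact Or.inl (A.hQa d hd v hv)
    · exact Or.inr (Or.inr (Or.inl ⟨d, hd, hv⟩))
    · obtain ⟨-, d', hd', heq⟩ := hCd d hd
      exact Or.inr (Or.inl ⟨d', hd', heq ▸ hv⟩)

/-- **Inner gluing, bottom dual arm** (mirror image): the dual corridor crossing ends on the face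
row `{x₁ = -n + 1}` (the bottom row of the inner fence box), stays in `{x₁ ≥ -n + 1}`, starts in
`{x₁ ≥ -n + n/8}` and lies in the column band while `x₁ ≤ -n + n/8`. [cite: Nolin2008, §4.3, proof of Prop. 12 (arXiv 0711.4948: Prop. 11)] -/
theorem ZdSepDualArmB.exists_faceWalk_of_innerCorridor
    (A : ZdSepDualArmB ω n N B₀ (B₀ + (n / 64 : ℕ)) lo' hi') (he : 1 ≤ n / 8)
    (T : (zdGraph 2).Walk s y) (hy : y 1 = -(n : ℤ) + 1) (hs : -(n : ℤ) + (n / 8 : ℕ) ≤ s 1)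
    (hT : ∀ z ∈ T.support, -(n : ℤ) + 1 ≤ z 1 ∧ (z 1 ≤ -(n : ℤ) + (n / 8 : ℕ) → B₀ ≤ z 0 ∧ z 0 ≤ B₀ + (n / 64 : ℕ))) :
    ∃ m ∈ T.support, ∃ U : (zdGraph 2).Walk A.f m,
      (∀ z ∈ U.support, z ∈ A.P'.support ∨ z ∈ A.C'.support) ∧
      (∀ d ∈ U.darts, sepEdge d.fst d.snd ∉ ω) ∧
      (∀ d ∈ U.darts, ∀ v ∈ sepEdge d.fst d.snd, v ∈ A.fenceSites) := by
  obtain ⟨q, T₁, hq, hT₁s, -⟩ :=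
    exists_prefix_reach_ge 1 T.reverse (-(n : ℤ) + (n / 8 : ℕ)) (by rw [hy]; omega) hs
  have hbox : ∀ z ∈ T₁.support, B₀ ≤ z 0 ∧ z 0 ≤ B₀ + (n / 64 : ℕ) ∧
      -(n : ℤ) + 1 ≤ z 1 ∧ z 1 ≤ -(n : ℤ) + (n / 8 : ℕ) := by
    intro z hz
    obtain ⟨h1, h2⟩ := hT₁s z hz
    rw [Walk.support_reverse, List.mem_reverse] at h2
    obtain ⟨h3, h4⟩ := hT z h2
    exact ⟨(h4 h1).1, (h4 h1).2, h3, h1⟩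
  have hf := A.hf
  obtain ⟨m, hmT, hmC⟩ := exists_mem_support_of_hFence (L₀ := B₀) (L₁ := B₀ + (n / 64 : ℕ))
    (B := -(n : ℤ) + 1) (B' := -(n : ℤ) + (n / 8 : ℕ)) A.C'
    (fun z hz => ⟨(A.hC' z hz).2.1, (A.hC' z hz).2.2⟩)
    (by rw [A.hab'.1]; omega) (by rw [A.hab'.2]; omega) (by omega) T₁ hy hq hbox
  obtain ⟨Uc, hUcs, hUcd⟩ := exists_faceWalk_within_support A.C' A.hu' hmC
  have hCd : ∀ d ∈ Uc.darts, sepEdge d.fst d.snd ∉ ω ∧ ∃ d' ∈ A.C'.darts, sepEdge d.fst d.snd = sepEdge d'.fst d'.snd := by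
    intro d hd
    rcases hUcd d hd with h | h
    · exact ⟨A.hC'c d h, d, h, rfl⟩
    · refine ⟨?_, d.symm, h, (sepEdge_dart_symm d).symm⟩
      rw [← sepEdge_dart_symm]; exact A.hC'c _ h
  have hmT' : m ∈ T.support := by
    have := (hT₁s m hmT).2
    rwa [Walk.support_reverse, List.mem_reverse] at this
  refine ⟨m, hmT', A.P'.append Uc, fun z hz => ?_, fun d hd => ?_, fun d hd v hv => ?_⟩
  · rw [Walk.mem_support_append_iff] at hz
    rcases hz with hz | hz
    · exact Or.inl hz
    · exact Or.inr (hUcs z hz)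
  · rw [Walk.darts_append, List.mem_append] at hd
    rcases hd with hd | hd
    · exact A.hP'c d hd
    · exact (hCd d hd).1
  · rw [Walk.darts_append, List.mem_append] at hd
    rcases hd with hd | hd
    · exact Or.inr (Or.inr (Or.inr ⟨d, hd, hv⟩))
    · obtain ⟨-, d', hd', heq⟩ := hCd d hd
      exact Or.inr (Or.inr (Or.inl ⟨d', hd', heq ▸ hv⟩))

end GlueDual

end Literature.Probability.Percolation
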